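import Mathlib
import Summits.RiemannHypothesis.RiemannHypothesis.Theorems.HandoffInertiaCount
import HarnessLib

/-!
# HANDOFF — FORM BOUNDS ARE EIGENVALUE BOUNDS; RAYLEIGH; THE HELLMANN–FEYNMAN / HADAMARD BRACKET FOR THE BOTTOM
# (cell rh-explicit, TRACK «HANDOFF», seat theory-2 gen12; FILE XII-yy; finite-dimensional folklore, on XII-y's inertia count)

HONEST FRAMING. Nothing in this file bears on the truth of RH; it is elementary real linear algebra for a real symmetric matrix `A`
and Mathlib's spectral-theorem eigenvalues `hA.eigenvalues : n → ℝ`. It types two dictionary entries the cell's custody words use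
every hour and one inequality behind the cell's newest structural DATA:
§1 «CERTIFIED ε₁» ⟷ «CERTIFIED FORM BOUND»: `(∀ x, c‖x‖² ≤ x·Ax) ↔ (∀ i, c ≤ λᵢ)` (`forall_le_form_iff_forall_le_eigenvalues`; upper
   version `forall_form_le_iff_forall_eigenvalues_le`). → : test on the eigenvectors; ← : if some `x` had `x·Ax < c‖x‖²`, XII-y's count
   `sigNeg(A − c·1) = #{i | λᵢ − c < 0}` would produce an eigenvalue below `c` (completeness of the eigenbasis enters only through
   XII-y's dimension count — no explicit diagonalisation is unpacked here). The producers' residual-Cholesky certificates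
   (`A − ε·1 = LLᵀ + E`, ‖E‖ small) are FORM bounds; this is the sentence that makes them eigenvalue enclosures, and back.
§2 RAYLEIGH in existence form: for `x ≠ 0` some eigenvalue is `≤ x·Ax/‖x‖²` and some is `≥` it (`exists_eigenvalues_mul_le`,
   `exists_le_eigenvalues_mul`) — «finite sections give UPPER bounds for the bottom» (HANDOFF-STATEMENT §H.3) for matrices; the sorted
   form is XII-z′'s `eigenvalues₀_last_mul_le`.
§3 THE HELLMANN–FEYNMAN / HADAMARD BRACKET: if `A v = λ v`, `v ≠ 0`, then `A + E` has an eigenvalue `≤ λ + (v·Ev)/‖v‖²`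
   (`exists_eigenvalues_add_mul_le`; with Mathlib's unit eigenvectors `exists_eigenvalues_add_le_eigenvalues_add`: every diagonal
   element `λⱼ + eⱼ·E eⱼ` caps the new bottom) — first-order perturbation theory as a rigorous one-sided bound; the zeroth-order floor
   `a + e ≤ λᵢ(A + E)` from form bounds (`forall_le_eigenvalues_add`, Weyl). For the rank-one LOWERING step `A − s·u uᵀ`, `s ≥ 0` — the
   shape of a section's bandwidth step on the near-null ladder in the cell's DATA (LADDER note (L5): «Δλ_k/Δb = −C_H·η_k² rung by
   rung to 0.1 %», i.e. `ΔG ≈ −C_H·Δb·e eᵀ`, DERIVED-CHECK single-lineage) — the bottom moves by `Δ ∈ [−s‖u‖², −s (u·v̂)²]`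
   (`exists_eigenvalues_sub_rankOne_mul_le`, `forall_le_eigenvalues_sub_rankOne`): the Hadamard rate is the UPPER end exactly.
§4 CONCAVITY OF THE BOTTOM along matrix segments, in bound form (`forall_le_eigenvalues_convexComb`).
What is NOT here (DATA/MODEL): that the bandwidth derivative of a Weil-form section IS rank-one on the ladder, the constant C_H, the
uniform log-decay rate r(b), anything infinite-dimensional (the cell's λ_min(S; t; σ) objects live in `HandoffSemilocalEnergy`) or
about ζ. No `def`s. References (folklore): Lord Rayleigh, Theory of Sound §88 (1877); H. Hellmann, Einführung in die Quantenchemie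
(1937) §1.5; R. P. Feynman, Phys. Rev. 56 (1939) 340; J. Hadamard, Mém. prés. Acad. Sci. 33 (1908) (variation of domain functionals)
— as read in Horn–Johnson, Matrix Analysis, Thm 4.2.2 and Kato, Perturbation Theory, II-§6. Companions: XII-y `HandoffInertiaCount`
(imported), XII-z `HandoffWeylCounting`, XII-z′ `HandoffEigenvalueOrder`.
-/

set_option linter.dupNamespace false  -- the mandated namespace repeats `RiemannHypothesis`

open Matrix Finset Module
open Summit.RiemannHypothesis.RiemannHypothesis.Theorems.HandoffInertiaCount

namespace Summit.RiemannHypothesis.RiemannHypothesis.Theorems.HandoffSpectralBounds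

variable {n : Type*} [Fintype n] [DecidableEq n]

/-! ## §1 A certified bound on the form is a bound on every eigenvalue, and conversely -/

/-- The diagonal matrix element of `A` at its `i`-th eigenvector is the eigenvalue: `eᵢ·(A eᵢ) = λᵢ`. [folklore] -/
theorem eigenvectorBasis_dotProduct_mulVec {A : Matrix n n ℝ} (hA : A.IsHermitian) (i : n) :
    (⇑(hA.eigenvectorBasis i) : n → ℝ) ⬝ᵥ A *ᵥ ⇑(hA.eigenvectorBasis i) = hA.eigenvalues i := by
  rw [hA.mulVec_eigenvectorBasis i, dotProduct_smul, eigenvectorBasis_dotProduct hA, if_pos rfl, smul_eq_mul, mul_one]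

/-- **LOWER FORM BOUND ⟹ EVERY EIGENVALUE IS ABOVE IT.** If `c‖x‖² ≤ x·Ax` for all `x` (e.g. a CERTIFIED residual-Cholesky bound
`A − c·1 ⪰ 0`), then `c ≤ λᵢ` for every eigenvalue. (Test the bound on the eigenvector.) [folklore] -/
theorem forall_le_eigenvalues_of_forall_le_form {A : Matrix n n ℝ} (hA : A.IsHermitian) {c : ℝ}
    (h : ∀ x : n → ℝ, c * (x ⬝ᵥ x) ≤ x ⬝ᵥ A *ᵥ x) (i : n) : c ≤ hA.eigenvalues i := by
  simpa [eigenvectorBasis_dotProduct hA, eigenvectorBasis_dotProduct_mulVec] using h ⇑(hA.eigenvectorBasis i)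

/-- **UPPER FORM BOUND ⟹ EVERY EIGENVALUE IS BELOW IT.** [folklore] -/
theorem forall_eigenvalues_le_of_forall_form_le {A : Matrix n n ℝ} (hA : A.IsHermitian) {C : ℝ}
    (h : ∀ x : n → ℝ, x ⬝ᵥ A *ᵥ x ≤ C * (x ⬝ᵥ x)) (i : n) : hA.eigenvalues i ≤ C := by
  simpa [eigenvectorBasis_dotProduct hA, eigenvectorBasis_dotProduct_mulVec] using h ⇑(hA.eigenvectorBasis i)

/-- **EVERY EIGENVALUE ABOVE c ⟹ THE FORM IS ABOVE c‖x‖².** (If some `x` had `x·Ax < c‖x‖²`, then `A − c·1` would have a negative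
vector, hence — XII-y's count `sigNeg = #{λᵢ − c < 0}` — an eigenvalue below `c`.) This is the completeness half: the eigenvalue
enclosure IS a form bound. [folklore] -/
theorem forall_le_form_of_forall_le_eigenvalues {A : Matrix n n ℝ} (hA : A.IsHermitian) {c : ℝ} (h : ∀ i, c ≤ hA.eigenvalues i)
    (x : n → ℝ) : c * (x ⬝ᵥ x) ≤ x ⬝ᵥ A *ᵥ x := by
  by_contra hlt
  push Not at hlt
  have hneg : x ⬝ᵥ (A - c • (1 : Matrix n n ℝ)) *ᵥ x < 0 := by
    rw [sub_mulVec, smul_mulVec, one_mulVec, dotProduct_sub, dotProduct_smul, smul_eq_mul]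
    linarith
  have h1 := one_le_sigNeg_of_neg _ hneg
  rw [sigNeg_eq_card_of_orthonormal_eigenvectors (A - c • (1 : Matrix n n ℝ)) (fun i ↦ ⇑(hA.eigenvectorBasis i))
    (fun i ↦ hA.eigenvalues i - c) (eigenvectorBasis_dotProduct hA) fun i ↦ by
      rw [sub_mulVec, smul_mulVec, one_mulVec, hA.mulVec_eigenvectorBasis i, sub_smul]] at h1
  obtain ⟨⟨i, hi⟩⟩ := Fintype.card_pos_iff.mp h1
  linarith [h i]

/-- **EVERY EIGENVALUE BELOW C ⟹ THE FORM IS BELOW C‖x‖².** [folklore] -/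
theorem forall_form_le_of_forall_eigenvalues_le {A : Matrix n n ℝ} (hA : A.IsHermitian) {C : ℝ} (h : ∀ i, hA.eigenvalues i ≤ C)
    (x : n → ℝ) : x ⬝ᵥ A *ᵥ x ≤ C * (x ⬝ᵥ x) := by
  by_contra hlt
  push Not at hlt
  have hneg : x ⬝ᵥ (C • (1 : Matrix n n ℝ) - A) *ᵥ x < 0 := by
    rw [sub_mulVec, smul_mulVec, one_mulVec, dotProduct_sub, dotProduct_smul, smul_eq_mul]
    linarith
  have h1 := one_le_sigNeg_of_neg _ hneg
  rw [sigNeg_eq_card_of_orthonormal_eigenvectors (C • (1 : Matrix n n ℝ) - A) (fun i ↦ ⇑(hA.eigenvectorBasis i))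
    (fun i ↦ C - hA.eigenvalues i) (eigenvectorBasis_dotProduct hA) fun i ↦ by
      rw [sub_mulVec, smul_mulVec, one_mulVec, hA.mulVec_eigenvectorBasis i, sub_smul]] at h1
  obtain ⟨⟨i, hi⟩⟩ := Fintype.card_pos_iff.mp h1
  linarith [h i]

/-- **THE DICTIONARY.** `(∀ x, c‖x‖² ≤ x·Ax) ↔ (∀ i, c ≤ λᵢ)`: a certified lower bound on the form and a lower bound on the
spectrum are the same statement — the sense in which the cell's certified `ε₁ ≥ …` (a form bound by residual Cholesky) is an
eigenvalue statement and vice versa. [folklore] -/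
theorem forall_le_form_iff_forall_le_eigenvalues {A : Matrix n n ℝ} (hA : A.IsHermitian) (c : ℝ) :
    (∀ x : n → ℝ, c * (x ⬝ᵥ x) ≤ x ⬝ᵥ A *ᵥ x) ↔ ∀ i, c ≤ hA.eigenvalues i :=
  ⟨fun h ↦ forall_le_eigenvalues_of_forall_le_form hA h, fun h ↦ forall_le_form_of_forall_le_eigenvalues hA h⟩

/-- The upper dictionary: `(∀ x, x·Ax ≤ C‖x‖²) ↔ (∀ i, λᵢ ≤ C)`. [folklore] -/
theorem forall_form_le_iff_forall_eigenvalues_le {A : Matrix n n ℝ} (hA : A.IsHermitian) (C : ℝ) :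
    (∀ x : n → ℝ, x ⬝ᵥ A *ᵥ x ≤ C * (x ⬝ᵥ x)) ↔ ∀ i, hA.eigenvalues i ≤ C :=
  ⟨fun h ↦ forall_eigenvalues_le_of_forall_form_le hA h, fun h ↦ forall_form_le_of_forall_eigenvalues_le hA h⟩

/-! ## §2 Rayleigh: every Rayleigh quotient lies between the smallest and the largest eigenvalue -/

/-- **RAYLEIGH, BOTTOM** (unsorted form): for `x ≠ 0` some eigenvalue satisfies `λᵢ‖x‖² ≤ x·Ax` — a finite section's bottom
eigenvalue is below every Rayleigh quotient («sections are UPPER bounds», §H.3). [folklore] -/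
theorem exists_eigenvalues_mul_le {A : Matrix n n ℝ} (hA : A.IsHermitian) {x : n → ℝ} (hx : x ≠ 0) :
    ∃ i, hA.eigenvalues i * (x ⬝ᵥ x) ≤ x ⬝ᵥ A *ᵥ x := by
  classical
  have hxx : 0 < x ⬝ᵥ x := by simpa using dotProduct_star_self_pos_iff.mpr hx
  obtain ⟨i⟩ : Nonempty n := by
    by_contra h
    rw [not_nonempty_iff] at h
    exact hx (funext fun i ↦ (IsEmpty.false i).elim)
  obtain ⟨i₀, -, hi₀⟩ := Finset.exists_min_image Finset.univ hA.eigenvalues ⟨i, Finset.mem_univ i⟩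
  exact ⟨i₀, forall_le_form_of_forall_le_eigenvalues hA (fun j ↦ hi₀ j (Finset.mem_univ j)) x⟩

/-- **RAYLEIGH, TOP** (unsorted form): for `x ≠ 0` some eigenvalue satisfies `x·Ax ≤ λᵢ‖x‖²`. [folklore] -/
theorem exists_le_eigenvalues_mul {A : Matrix n n ℝ} (hA : A.IsHermitian) {x : n → ℝ} (hx : x ≠ 0) :
    ∃ i, x ⬝ᵥ A *ᵥ x ≤ hA.eigenvalues i * (x ⬝ᵥ x) := by
  classical
  obtain ⟨i⟩ : Nonempty n := by
    by_contra h
    rw [not_nonempty_iff] at h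
    exact hx (funext fun i ↦ (IsEmpty.false i).elim)
  obtain ⟨i₀, -, hi₀⟩ := Finset.exists_max_image Finset.univ hA.eigenvalues ⟨i, Finset.mem_univ i⟩
  exact ⟨i₀, forall_form_le_of_forall_eigenvalues_le hA (fun j ↦ hi₀ j (Finset.mem_univ j)) x⟩

/-! ## §3 The Hellmann–Feynman / Hadamard bracket for the bottom eigenvalue of a perturbed matrix -/

/-- **FIRST-ORDER UPPER BOUND (Hellmann–Feynman / Rayleigh).** If `A v = λ v` with `v ≠ 0`, then `A + E` has an eigenvalue
`≤ λ + (v·Ev)/‖v‖²`: the first-order perturbation formula is a rigorous UPPER bound for the bottom. With `v` the bottom eigenvector of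
`A` and `E = ΔG` the bandwidth step of a section, this is the Hadamard identity's first-order term (LADDER (L5): Δλ₀ ≈ −C_H·Δb·η₀²)
as a one-sided inequality. [folklore: Rayleigh; Hellmann 1937 / Feynman 1939 in first-order form] -/
theorem exists_eigenvalues_add_mul_le {A E : Matrix n n ℝ} (hAE : (A + E).IsHermitian) {v : n → ℝ} (hv : v ≠ 0) {lam : ℝ}
    (hAv : A *ᵥ v = lam • v) : ∃ i, hAE.eigenvalues i * (v ⬝ᵥ v) ≤ lam * (v ⬝ᵥ v) + v ⬝ᵥ E *ᵥ v := by
  obtain ⟨i, hi⟩ := exists_eigenvalues_mul_le hAE hv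
  refine ⟨i, ?_⟩
  rwa [add_mulVec, dotProduct_add, hAv, dotProduct_smul, smul_eq_mul] at hi

/-- The same with `v` = Mathlib's `j`-th eigenvector of a symmetric `A` (unit norm): `A + E` has an eigenvalue `≤ λⱼ(A) + eⱼ·E eⱼ` — every
diagonal matrix element of the perturbation in the old eigenbasis caps the new bottom from above. [folklore] -/
theorem exists_eigenvalues_add_le_eigenvalues_add {A E : Matrix n n ℝ} (hA : A.IsHermitian) (hAE : (A + E).IsHermitian) (j : n) :
    ∃ i, hAE.eigenvalues i ≤ hA.eigenvalues j + (⇑(hA.eigenvectorBasis j) : n → ℝ) ⬝ᵥ E *ᵥ ⇑(hA.eigenvectorBasis j) := by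
  have h1 : (⇑(hA.eigenvectorBasis j) : n → ℝ) ⬝ᵥ ⇑(hA.eigenvectorBasis j) = 1 := by
    rw [eigenvectorBasis_dotProduct hA, if_pos rfl]
  have hv : (⇑(hA.eigenvectorBasis j) : n → ℝ) ≠ 0 := fun h ↦ by
    rw [h, dotProduct_zero] at h1
    exact zero_ne_one h1
  obtain ⟨i, hi⟩ := exists_eigenvalues_add_mul_le hAE hv (hA.mulVec_eigenvectorBasis j)
  refine ⟨i, ?_⟩
  simpa [h1] using hi

/-- **ZEROTH-ORDER LOWER BOUND (Weyl).** If `a‖x‖² ≤ x·Ax` and `e‖x‖² ≤ x·Ex` for all `x`, then every eigenvalue of `A + E` is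
`≥ a + e`. [folklore] -/
theorem forall_le_eigenvalues_add {A E : Matrix n n ℝ} (hAE : (A + E).IsHermitian) {a e : ℝ}
    (ha : ∀ x : n → ℝ, a * (x ⬝ᵥ x) ≤ x ⬝ᵥ A *ᵥ x) (he : ∀ x : n → ℝ, e * (x ⬝ᵥ x) ≤ x ⬝ᵥ E *ᵥ x) (i : n) :
    a + e ≤ hAE.eigenvalues i :=
  forall_le_eigenvalues_of_forall_le_form hAE (fun x ↦ by rw [add_mulVec, dotProduct_add]; linarith [ha x, he x]) i

/-- **THE HADAMARD STEP, BRACKETED.** For the rank-one LOWERING step `A ↦ A − s·u uᵀ` (`s ≥ 0`; the bandwidth step of a section is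
`ΔG ≈ −C_H·Δb·e eᵀ` on the near-null ladder, LADDER (L5)): if `A v = λ v`, `v ≠ 0`, then `A − s·u uᵀ` has an eigenvalue
`≤ λ − s·(u·v)²/‖v‖²` (upper = the first-order Hadamard term exactly) … [folklore] -/
theorem exists_eigenvalues_sub_rankOne_mul_le {A : Matrix n n ℝ} {s : ℝ} (u : n → ℝ) (hP : (A - s • vecMulVec u u).IsHermitian)
    {v : n → ℝ} (hv : v ≠ 0) {lam : ℝ} (hAv : A *ᵥ v = lam • v) :
    ∃ i, hP.eigenvalues i * (v ⬝ᵥ v) ≤ lam * (v ⬝ᵥ v) - s * (u ⬝ᵥ v) ^ 2 := by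
  obtain ⟨i, hi⟩ := exists_eigenvalues_mul_le hP hv
  refine ⟨i, ?_⟩
  rwa [sub_mulVec, dotProduct_sub, hAv, dotProduct_smul, smul_eq_mul, smul_mulVec, Matrix.vecMulVec_mulVec, op_smul_eq_smul,
    dotProduct_smul, dotProduct_smul, smul_eq_mul, smul_eq_mul, dotProduct_comm v u, ← pow_two] at hi

/-- … and every eigenvalue of `A − s·u uᵀ` is `≥ a − s‖u‖²` when `a‖x‖² ≤ x·Ax` (lower = zeroth order, by Cauchy–Schwarz). Together:
`−s‖u‖² ≤ Δλ_min ≤ −s (u·v̂)²` for the bottom, the two-sided bracket around the Hadamard rate. [folklore] -/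
theorem forall_le_eigenvalues_sub_rankOne {A : Matrix n n ℝ} {s : ℝ} (hs : 0 ≤ s) (u : n → ℝ)
    (hP : (A - s • vecMulVec u u).IsHermitian) {a : ℝ} (ha : ∀ x : n → ℝ, a * (x ⬝ᵥ x) ≤ x ⬝ᵥ A *ᵥ x) (i : n) :
    a - s * (u ⬝ᵥ u) ≤ hP.eigenvalues i := by
  refine forall_le_eigenvalues_of_forall_le_form hP (fun x ↦ ?_) i
  have hcs : (u ⬝ᵥ x) * (u ⬝ᵥ x) ≤ (u ⬝ᵥ u) * (x ⬝ᵥ x) := by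
    simpa [dotProduct, pow_two] using Finset.sum_mul_sq_le_sq_mul_sq Finset.univ u x
  rw [sub_mulVec, dotProduct_sub, smul_mulVec, Matrix.vecMulVec_mulVec, op_smul_eq_smul, dotProduct_smul, dotProduct_smul,
    smul_eq_mul, smul_eq_mul, dotProduct_comm x u]
  nlinarith [ha x, mul_le_mul_of_nonneg_left hcs hs]

/-! ## §4 Concavity of the bottom: form bounds add along convex combinations -/

/-- **THE BOTTOM IS CONCAVE ALONG MATRIX SEGMENTS**, in bound form: if every eigenvalue of `A₀` is `≥ a₀` and every eigenvalue of
`A₁` is `≥ a₁`, then every eigenvalue of `(1 − θ)A₀ + θA₁` (`0 ≤ θ ≤ 1`) is `≥ (1 − θ)a₀ + θa₁`. [folklore] -/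
theorem forall_le_eigenvalues_convexComb {A₀ A₁ : Matrix n n ℝ} (h₀ : A₀.IsHermitian) (h₁ : A₁.IsHermitian) {θ : ℝ} (hθ₀ : 0 ≤ θ)
    (hθ₁ : θ ≤ 1) (hθ : ((1 - θ) • A₀ + θ • A₁).IsHermitian) {a₀ a₁ : ℝ} (ha₀ : ∀ i, a₀ ≤ h₀.eigenvalues i)
    (ha₁ : ∀ i, a₁ ≤ h₁.eigenvalues i) (i : n) : (1 - θ) * a₀ + θ * a₁ ≤ hθ.eigenvalues i := by
  refine forall_le_eigenvalues_of_forall_le_form hθ (fun x ↦ ?_) i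
  have e₀ := forall_le_form_of_forall_le_eigenvalues h₀ ha₀ x
  have e₁ := forall_le_form_of_forall_le_eigenvalues h₁ ha₁ x
  rw [add_mulVec, smul_mulVec, smul_mulVec, dotProduct_add, dotProduct_smul, dotProduct_smul, smul_eq_mul, smul_eq_mul]
  have h1θ : 0 ≤ 1 - θ := by linarith
  nlinarith [mul_le_mul_of_nonneg_left e₀ h1θ, mul_le_mul_of_nonneg_left e₁ hθ₀]

end Summit.RiemannHypothesis.RiemannHypothesis.Theorems.HandoffSpectralBounds
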